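/-
Summits/MatrixMultiplication/MatrixMultiplication/Theorems/TetraResidualNecessityCore.lean
decomp-mm lens 6 («barrier-complement carving»), generation 27 — supports item 27058 (TetraPlusTwo,
the declared residual of route TetrahedronCarving).  Part 1/3: abstract carrier.
-/
import Mathlib

/-!
# Residual necessity, part 1: worlds, forcing, stability; support-linear pieces

Pure convex/filter geometry (no tensor input).  See `TetraResidualNecessity` (part 2) for the
interpretation on the tetrahedron carrier and the headline theorems, and
`TetraResidualNecessityInstances` (part 3) for the dossier pieces, the record box and the
rectangular carrier.

* `Forces Δ₀ K Ps S`: every world `Δ` with `Δ₀ ⊆ Δ ⊆ K` satisfying all pieces `Ps` satisfies `S`.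
* `StableAlong Δ₀ C P`: `P` survives adjoining the finite perturbation set `C ε` for small `ε>0`.
* `not_forces_of_stable` / `exists_unstable_of_forces`: stable families never force a piece
  that fails on the perturbed worlds.
* `sval Δ u = sSup (⟨u,·⟩ '' Δ)` (support value = exponent of the weighted object `u`),
  `LinData` (pieces `∑ j, coef_j · sval Δ u_j ≤ rhs`), `LinData.stable_of_slack` (slack positive
  terms ⟹ stable), `residual_necessity` (a forcing family has a positive term TIGHT at a base
  point and seeing the perturbation), `omegaFree_not_forces`.
-/

open Filter Topology Set

namespace Summit.MatrixMultiplication.MatrixMultiplication.Theorems.TetraResidualNecessity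

/-! ### 1. Worlds, pieces, forcing, stability (abstract carrier) -/

section Abstract

variable {Pt : Type*}

/-- `Ps` forces `S` relative to the mandatory set `Δ₀` and the lawful region `K`: every world
`Δ` with `Δ₀ ⊆ Δ ⊆ K` satisfying every piece of `Ps` satisfies `S`. -/
def Forces (Δ₀ K : Set Pt) (Ps : List (Set Pt → Prop)) (S : Set Pt → Prop) : Prop :=
  ∀ Δ : Set Pt, Δ₀ ⊆ Δ → Δ ⊆ K → (∀ P ∈ Ps, P Δ) → S Δ

/-- A piece is stable along the perturbation `C` (a set of points for every `ε`) if it survives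
adjoining `C ε` to `Δ₀` for all small `ε > 0`. -/
def StableAlong (Δ₀ : Set Pt) (C : ℝ → Set Pt) (P : Set Pt → Prop) : Prop :=
  ∀ᶠ ε in 𝓝[>] (0 : ℝ), P (Δ₀ ∪ C ε)

/-- finitely many stable pieces are simultaneously stable -/
theorem stableAlong_list (Δ₀ : Set Pt) (C : ℝ → Set Pt) (Ps : List (Set Pt → Prop))
    (h : ∀ P ∈ Ps, StableAlong Δ₀ C P) :
    ∀ᶠ ε in 𝓝[>] (0 : ℝ), ∀ P ∈ Ps, P (Δ₀ ∪ C ε) := by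
  induction Ps with
  | nil => exact Eventually.of_forall (fun ε P hP => by simp at hP)
  | cons Q Qs ih =>
      have hQ : StableAlong Δ₀ C Q := h Q (by simp)
      have hQs : ∀ P ∈ Qs, StableAlong Δ₀ C P := fun P hP => h P (by simp [hP])
      filter_upwards [hQ, ih hQs] with ε h1 h2
      intro P hP
      rcases List.mem_cons.mp hP with rfl | hP'
      · exact h1
      · exact h2 P hP'

/-- **Stable pieces never force.**  If every piece of `Ps` is stable along `C`, the perturbation
stays in `K`, and `S` fails on the perturbed worlds, then `Ps` does not force `S`. -/
theorem not_forces_of_stable {Δ₀ K : Set Pt} {C : ℝ → Set Pt} {Ps : List (Set Pt → Prop)}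
    {S : Set Pt → Prop} (hK : Δ₀ ⊆ K) (hroom : ∀ᶠ ε in 𝓝[>] (0 : ℝ), C ε ⊆ K)
    (hS : ∀ᶠ ε in 𝓝[>] (0 : ℝ), ¬ S (Δ₀ ∪ C ε))
    (hst : ∀ P ∈ Ps, StableAlong Δ₀ C P) : ¬ Forces Δ₀ K Ps S := by
  intro hF
  obtain ⟨ε, hεK, hεS, hεP⟩ := (hroom.and (hS.and (stableAlong_list Δ₀ C Ps hst))).exists
  exact hεS (hF _ subset_union_left (union_subset hK hεK) hεP)

/-- Contrapositive: a forcing family has an unstable member. -/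
theorem exists_unstable_of_forces {Δ₀ K : Set Pt} {C : ℝ → Set Pt} {Ps : List (Set Pt → Prop)}
    {S : Set Pt → Prop} (hK : Δ₀ ⊆ K) (hroom : ∀ᶠ ε in 𝓝[>] (0 : ℝ), C ε ⊆ K)
    (hS : ∀ᶠ ε in 𝓝[>] (0 : ℝ), ¬ S (Δ₀ ∪ C ε)) (hF : Forces Δ₀ K Ps S) :
    ∃ P ∈ Ps, ¬ StableAlong Δ₀ C P := by
  by_contra h
  push Not at h
  exact not_forces_of_stable hK hroom hS h hF

end Abstract

/-! ### 2. Support values and support-linear pieces -/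

section Linear

variable {ι : Type*} [Fintype ι]

/-- pairing `⟨u,β⟩` -/
def dot (u β : ι → ℝ) : ℝ := ∑ i, u i * β i

/-- linearity of the pairing along a perturbation `x + ε v` -/
theorem dot_add_smul (u x v : ι → ℝ) (ε : ℝ) :
    dot u (x + ε • v) = dot u x + ε * dot u v := by
  simp only [dot, Pi.add_apply, Pi.smul_apply, smul_eq_mul, Finset.mul_sum]
  rw [← Finset.sum_add_distrib]
  exact Finset.sum_congr rfl (fun i _ => by ring)

/-- homogeneity of the pairing in the direction -/
theorem dot_smul_left (μ : ℝ) (u β : ι → ℝ) : dot (μ • u) β = μ * dot u β := by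
  simp only [dot, Pi.smul_apply, smul_eq_mul, Finset.mul_sum]
  exact Finset.sum_congr rfl (fun i _ => by ring)

/-- support value of the direction `u` over the world `Δ` (the exponent of the weighted object
`u` in that world) -/
noncomputable def sval (Δ : Set (ι → ℝ)) (u : ι → ℝ) : ℝ := sSup (dot u '' Δ)

/-- standing regularity of a mandatory set: nonempty and bounded in every direction -/
structure Tame (Δ₀ : Set (ι → ℝ)) : Prop where
  nonempty : Δ₀.Nonempty
  bdd : ∀ u, BddAbove (dot u '' Δ₀)

/-- a finite nonempty mandatory set is tame -/
theorem tame_of_finite {Δ₀ : Set (ι → ℝ)} (hfin : Δ₀.Finite) (hne : Δ₀.Nonempty) : Tame Δ₀ :=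
  ⟨hne, fun _ => (hfin.image _).bddAbove⟩

/-- every point of the world bounds the support value from below -/
theorem le_sval {Δ₀ : Set (ι → ℝ)} (hΔ : Tame Δ₀) (u : ι → ℝ) {β : ι → ℝ} (hβ : β ∈ Δ₀) :
    dot u β ≤ sval Δ₀ u :=
  le_csSup (hΔ.bdd u) (mem_image_of_mem _ hβ)

/-- a uniform bound on the world bounds the support value from above -/
theorem sval_le {Δ₀ : Set (ι → ℝ)} (hΔ : Tame Δ₀) (u : ι → ℝ) {M : ℝ}
    (h : ∀ β ∈ Δ₀, dot u β ≤ M) : sval Δ₀ u ≤ M :=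
  csSup_le (hΔ.nonempty.image _) (by rintro _ ⟨β, hβ, rfl⟩; exact h β hβ)

/-- adjoining finitely many points keeps every direction bounded -/
theorem bddAbove_union {Δ₀ : Set (ι → ℝ)} (hΔ : Tame Δ₀) {F : Set (ι → ℝ)} (hF : F.Finite)
    (u : ι → ℝ) : BddAbove (dot u '' (Δ₀ ∪ F)) := by
  rw [image_union]
  exact (hΔ.bdd u).union (hF.image _).bddAbove

/-- adjoining points can only raise support values -/
theorem sval_le_sval_union {Δ₀ : Set (ι → ℝ)} (hΔ : Tame Δ₀) {F : Set (ι → ℝ)}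
    (hF : F.Finite) (u : ι → ℝ) : sval Δ₀ u ≤ sval (Δ₀ ∪ F) u :=
  csSup_le_csSup (bddAbove_union hΔ hF u) (hΔ.nonempty.image _) (image_mono subset_union_left)

/-- an adjoined point bounds the new support value from below -/
theorem dot_le_sval_union {Δ₀ : Set (ι → ℝ)} (hΔ : Tame Δ₀) {F : Set (ι → ℝ)} (hF : F.Finite)
    (u : ι → ℝ) {p : ι → ℝ} (hp : p ∈ F) : dot u p ≤ sval (Δ₀ ∪ F) u :=
  le_csSup (bddAbove_union hΔ hF u) (mem_image_of_mem _ (mem_union_right Δ₀ hp))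

/-- adjoining points below the old support value does not change it -/
theorem sval_union_le {Δ₀ : Set (ι → ℝ)} (hΔ : Tame Δ₀) {F : Set (ι → ℝ)} {u : ι → ℝ}
    {M : ℝ} (h₀ : sval Δ₀ u ≤ M) (hF : ∀ p ∈ F, dot u p ≤ M) : sval (Δ₀ ∪ F) u ≤ M :=
  csSup_le ((hΔ.nonempty.mono subset_union_left).image _) (by
    rintro _ ⟨β, hβ, rfl⟩
    rcases hβ with hβ | hβ
    · exact (le_sval hΔ u hβ).trans h₀
    · exact hF β hβ)

/-- the finite perturbation set attached to a list of pairs `(x_k, v_k)`: `{x_k + ε v_k}` -/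
def pts (pert : List ((ι → ℝ) × (ι → ℝ))) (ε : ℝ) : Set (ι → ℝ) :=
  {p | p ∈ pert.map (fun xv => xv.1 + ε • xv.2)}

omit [Fintype ι] in
/-- the perturbation set is finite -/
theorem pts_finite (pert : List ((ι → ℝ) × (ι → ℝ))) (ε : ℝ) : (pts pert ε).Finite :=
  List.finite_toSet _

omit [Fintype ι] in
/-- each `x_k + ε v_k` belongs to the perturbation set -/
theorem mem_pts {pert : List ((ι → ℝ) × (ι → ℝ))} (ε : ℝ) {xv : (ι → ℝ) × (ι → ℝ)}
    (h : xv ∈ pert) : xv.1 + ε • xv.2 ∈ pts pert ε := by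
  simp only [pts, mem_setOf_eq, List.mem_map]
  exact ⟨xv, h, rfl⟩

omit [Fintype ι] in
/-- every point of the perturbation set is some `x_k + ε v_k` -/
theorem exists_of_mem_pts {pert : List ((ι → ℝ) × (ι → ℝ))} {ε : ℝ} {p : ι → ℝ}
    (hp : p ∈ pts pert ε) : ∃ xv ∈ pert, p = xv.1 + ε • xv.2 := by
  simp only [pts, mem_setOf_eq, List.mem_map] at hp
  obtain ⟨xv, hxv, rfl⟩ := hp
  exact ⟨xv, hxv, rfl⟩

omit [Fintype ι] in
/-- room: if every perturbation point is eventually lawful, the perturbation set is -/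
theorem pts_room {pert : List ((ι → ℝ) × (ι → ℝ))} {K : Set (ι → ℝ)}
    (h : ∀ xv ∈ pert, ∀ᶠ ε in 𝓝[>] (0 : ℝ), xv.1 + ε • xv.2 ∈ K) :
    ∀ᶠ ε in 𝓝[>] (0 : ℝ), pts pert ε ⊆ K := by
  have hall : ∀ᶠ ε in 𝓝[>] (0 : ℝ), ∀ xv ∈ {x | x ∈ pert}, xv.1 + ε • xv.2 ∈ K :=
    (eventually_all_finite (List.finite_toSet pert)).mpr h
  filter_upwards [hall] with ε hε
  intro p hp
  obtain ⟨xv, hxv, rfl⟩ := exists_of_mem_pts hp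
  exact hε xv hxv

/-- the summit-type piece `sval Δ t ≤ s` (for the summit: `t = tri`, `s = 2`, i.e. `ω ≤ 2`) -/
def Cap (t : ι → ℝ) (s : ℝ) : Set (ι → ℝ) → Prop := fun Δ => sval Δ t ≤ s

/-- the summit piece fails after adjoining `x + ε v` whenever `⟨t,x⟩ = s` and `⟨t,v⟩ > 0` -/
theorem cap_fails {Δ₀ : Set (ι → ℝ)} (hΔ : Tame Δ₀) (pert : List ((ι → ℝ) × (ι → ℝ)))
    {t : ι → ℝ} {s : ℝ} {xv : (ι → ℝ) × (ι → ℝ)} (hxv : xv ∈ pert) (ht : dot t xv.1 = s)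
    (hv : 0 < dot t xv.2) :
    ∀ᶠ ε in 𝓝[>] (0 : ℝ), ¬ Cap t s (Δ₀ ∪ pts pert ε) := by
  filter_upwards [self_mem_nhdsWithin] with ε hε
  have hε' : (0 : ℝ) < ε := hε
  have h1 : dot t (xv.1 + ε • xv.2) ≤ sval (Δ₀ ∪ pts pert ε) t :=
    dot_le_sval_union hΔ (pts_finite pert ε) t (mem_pts ε hxv)
  rw [dot_add_smul, ht] at h1
  have h2 : 0 < ε * dot t xv.2 := mul_pos hε' hv
  unfold Cap
  rw [not_le]
  linarith

/-- data of a support-linear piece `∑ j, coef j · sval Δ (dir j) ≤ rhs` -/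
structure LinData (ι : Type*) where
  n : ℕ
  coef : Fin n → ℝ
  dir : Fin n → ι → ℝ
  rhs : ℝ

/-- the piece defined by the data -/
def LinData.holds (D : LinData ι) (Δ : Set (ι → ℝ)) : Prop :=
  ∑ j, D.coef j * sval Δ (D.dir j) ≤ D.rhs

/-- an elementary `ε`-room lemma: `⟨u,x⟩ < M ⟹ ⟨u, x + ε v⟩ < M` for small `ε > 0` -/
theorem eventually_dot_lt {u x v : ι → ℝ} {M : ℝ} (h : dot u x < M) :
    ∀ᶠ ε in 𝓝[>] (0 : ℝ), dot u (x + ε • v) < M := by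
  set g : ℝ := M - dot u x with hg
  have hgpos : 0 < g := by rw [hg]; linarith
  set δ : ℝ := g / (|dot u v| + 1) with hδ
  have hden : 0 < |dot u v| + 1 := by positivity
  have hδpos : 0 < δ := by rw [hδ]; positivity
  have hδg : δ * (|dot u v| + 1) = g := by rw [hδ]; field_simp
  filter_upwards [Ioo_mem_nhdsGT hδpos] with ε hε
  rcases hε with ⟨hε0, hεδ⟩
  rw [dot_add_smul]
  have h1 : ε * dot u v ≤ ε * |dot u v| := mul_le_mul_of_nonneg_left (le_abs_self _) hε0.le
  have h2 : ε * |dot u v| ≤ δ * |dot u v| := mul_le_mul_of_nonneg_right hεδ.le (abs_nonneg _)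
  nlinarith

/-- **Stability criterion for support-linear pieces.**  A support-linear piece true at `Δ₀` is
stable along the perturbations `x_k + ε v_k` provided every term with a positive coefficient
whose direction sees a perturbation (`⟨u_j,v_k⟩ > 0`) is SLACK at its base point
(`⟨u_j,x_k⟩ < sval Δ₀ u_j`); the base points are assumed dominated by `Δ₀`. -/
theorem LinData.stable_of_slack (D : LinData ι) {Δ₀ : Set (ι → ℝ)} (hΔ : Tame Δ₀)
    (hnec : D.holds Δ₀) (pert : List ((ι → ℝ) × (ι → ℝ)))
    (hx : ∀ xv ∈ pert, ∀ u, dot u xv.1 ≤ sval Δ₀ u)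
    (hslack : ∀ xv ∈ pert, ∀ j, 0 < D.coef j → 0 < dot (D.dir j) xv.2 →
      dot (D.dir j) xv.1 < sval Δ₀ (D.dir j)) :
    StableAlong Δ₀ (pts pert) D.holds := by
  have hev : ∀ xv ∈ pert, ∀ j, ∀ᶠ ε in 𝓝[>] (0 : ℝ),
      0 < D.coef j → dot (D.dir j) (xv.1 + ε • xv.2) ≤ sval Δ₀ (D.dir j) := by
    intro xv hxv j
    by_cases hj : 0 < D.coef j
    · by_cases hvj : 0 < dot (D.dir j) xv.2
      · filter_upwards [eventually_dot_lt (v := xv.2) (hslack xv hxv j hj hvj)] with ε hε _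
          using hε.le
      · push Not at hvj
        filter_upwards [self_mem_nhdsWithin] with ε hε _
        have hε' : (0 : ℝ) < ε := hε
        rw [dot_add_smul]
        have : ε * dot (D.dir j) xv.2 ≤ 0 := mul_nonpos_of_nonneg_of_nonpos hε'.le hvj
        linarith [hx xv hxv (D.dir j)]
    · exact Eventually.of_forall (fun ε h => absurd h hj)
  have hall : ∀ᶠ ε in 𝓝[>] (0 : ℝ), ∀ xv ∈ {x | x ∈ pert}, ∀ j,
      0 < D.coef j → dot (D.dir j) (xv.1 + ε • xv.2) ≤ sval Δ₀ (D.dir j) :=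
    (eventually_all_finite (List.finite_toSet pert)).mpr
      (fun xv hxv => eventually_all.mpr (hev xv hxv))
  filter_upwards [hall] with ε hε
  unfold LinData.holds at hnec ⊢
  refine le_trans ?_ hnec
  apply Finset.sum_le_sum
  intro j _
  by_cases hj : 0 < D.coef j
  · apply mul_le_mul_of_nonneg_left _ hj.le
    apply sval_union_le hΔ le_rfl
    intro p hp
    obtain ⟨xv, hxv, rfl⟩ := exists_of_mem_pts hp
    exact hε xv hxv j hj
  · push Not at hj
    exact mul_le_mul_of_nonpos_left (sval_le_sval_union hΔ (pts_finite pert ε) _) hj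

/-- An unstable support-linear piece (true at `Δ₀`) has a positive-coefficient term whose
direction sees some perturbation `v_k` and is tight at its base point `x_k`. -/
theorem LinData.exists_tight_of_unstable (D : LinData ι) {Δ₀ : Set (ι → ℝ)} (hΔ : Tame Δ₀)
    (hnec : D.holds Δ₀) (pert : List ((ι → ℝ) × (ι → ℝ)))
    (hx : ∀ xv ∈ pert, ∀ u, dot u xv.1 ≤ sval Δ₀ u)
    (hun : ¬ StableAlong Δ₀ (pts pert) D.holds) :
    ∃ xv ∈ pert, ∃ j, 0 < D.coef j ∧ 0 < dot (D.dir j) xv.2 ∧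
      sval Δ₀ (D.dir j) ≤ dot (D.dir j) xv.1 := by
  by_contra h
  push Not at h
  exact hun (D.stable_of_slack hΔ hnec pert hx h)

/-- **Residual necessity (abstract carrier).**  If a finite family of support-linear pieces,
each true at `Δ₀`, forces the cap `sval Δ t ≤ s`, and one of the lawful perturbations
`x_k + ε v_k` (base points dominated by `Δ₀`) has `⟨t,x_k⟩ = s`, `⟨t,v_k⟩ > 0`, then some piece
has a positive-coefficient term, seeing some `v_k'`, tight at `x_k'`. -/
theorem residual_necessity {Δ₀ K : Set (ι → ℝ)} (hΔ : Tame Δ₀) (hK : Δ₀ ⊆ K)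
    (pert : List ((ι → ℝ) × (ι → ℝ)))
    (hroom : ∀ xv ∈ pert, ∀ᶠ ε in 𝓝[>] (0 : ℝ), xv.1 + ε • xv.2 ∈ K)
    (hx : ∀ xv ∈ pert, ∀ u, dot u xv.1 ≤ sval Δ₀ u)
    {t : ι → ℝ} {s : ℝ} {xv₀ : (ι → ℝ) × (ι → ℝ)} (hxv₀ : xv₀ ∈ pert)
    (ht : dot t xv₀.1 = s) (hv : 0 < dot t xv₀.2)
    (Ps : List (LinData ι)) (hnec : ∀ D ∈ Ps, D.holds Δ₀)
    (hF : Forces Δ₀ K (Ps.map LinData.holds) (Cap t s)) :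
    ∃ D ∈ Ps, ∃ xv ∈ pert, ∃ j, 0 < D.coef j ∧ 0 < dot (D.dir j) xv.2 ∧
      sval Δ₀ (D.dir j) ≤ dot (D.dir j) xv.1 := by
  obtain ⟨P, hP, hunst⟩ :=
    exists_unstable_of_forces (C := pts pert) hK (pts_room hroom)
      (cap_fails hΔ pert hxv₀ ht hv) hF
  obtain ⟨D, hD, rfl⟩ := List.mem_map.mp hP
  exact ⟨D, hD, D.exists_tight_of_unstable hΔ (hnec D hD) pert hx hunst⟩

/-- ω-free families: if no piece has a positive-coefficient, perturbation-seeing, tight term,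
the family does not force the cap. -/
theorem omegaFree_not_forces {Δ₀ K : Set (ι → ℝ)} (hΔ : Tame Δ₀) (hK : Δ₀ ⊆ K)
    (pert : List ((ι → ℝ) × (ι → ℝ)))
    (hroom : ∀ xv ∈ pert, ∀ᶠ ε in 𝓝[>] (0 : ℝ), xv.1 + ε • xv.2 ∈ K)
    (hx : ∀ xv ∈ pert, ∀ u, dot u xv.1 ≤ sval Δ₀ u)
    {t : ι → ℝ} {s : ℝ} {xv₀ : (ι → ℝ) × (ι → ℝ)} (hxv₀ : xv₀ ∈ pert)
    (ht : dot t xv₀.1 = s) (hv : 0 < dot t xv₀.2)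
    (Ps : List (LinData ι)) (hnec : ∀ D ∈ Ps, D.holds Δ₀)
    (hfree : ∀ D ∈ Ps, ∀ xv ∈ pert, ∀ j, 0 < D.coef j → 0 < dot (D.dir j) xv.2 →
      dot (D.dir j) xv.1 < sval Δ₀ (D.dir j)) :
    ¬ Forces Δ₀ K (Ps.map LinData.holds) (Cap t s) := by
  intro hF
  obtain ⟨D, hD, xv, hxv, j, hj, hjv, htight⟩ :=
    residual_necessity hΔ hK pert hroom hx hxv₀ ht hv Ps hnec hF
  exact absurd (hfree D hD xv hxv j hj hjv) (not_lt.mpr htight)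

end Linear

end Summit.MatrixMultiplication.MatrixMultiplication.Theorems.TetraResidualNecessity
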